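import Summits.MatrixMultiplication.MatrixMultiplication.Theorems.SoloInformedTwistedMatchingsWeighted
import HarnessLib

/-!
# Twisted matchings in `A × T`, `A` a `p`-group with End-stable levels, `p ∤ |T|`

Solo-informed seat (MatrixMultiplication), gen 101; sequel of `SoloInformedTwistedMatchingsWeighted`.
The `p'`-part of a host group costs nothing but its cardinality: for a `p`-central generating
system `C` of `A` whose levels every endomorphism respects and ANY finite group `T` of order prime
to `p`, every endomorphism of `A × T` is diagonal (`monoidHom_prod_eq_of_coprime`), the product of
`C`'s graded coordinates with the trivial grading of `K[T]` (BCCGU 2017, Lemma 3.21) is filtered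
for all automorphism twists (`prod_trivial_pushforward_filtered`), and therefore a twisted matching
in `A × T` with finitely many automorphism-pair twists has at most
`(#{deg < a} + #{deg < b} + #{deg ≥ a+b}) · |T|` elements (`card_le_of_coprimeTwistedMatching`) —
the count for `A` times `|T|`. This is the reduction of the seat's Theorem B″ for abelian hosts of
bounded exponent to their largest Sylow subgroup (sharpest-statement §2y(8), clause (c)).
References: BlasiakChurchCohnGrochowUmans2017 (arXiv:1712.02302) Prop. 3.2, Lemma 3.21;
CohnUmans2013 (arXiv:1207.6528) §5, Conj. 21.
-/

noncomputable section

open scoped BigOperators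
open Finset Literature.Combinatorics.Additive Literature.Barriers.MatrixMultiplication

namespace Summit.MatrixMultiplication.MatrixMultiplication.Theorems.TwistedSliceRank

section Diagonal

/-- **Endomorphisms of a coprime product are diagonal**: if `x^a = 1` on `A`, `y^t = 1` on `T`
and `gcd(a,t) = 1`, every endomorphism `θ` of `A × T` satisfies
`θ(x,y) = ((θ(x,1))₁, (θ(1,y))₂)`. [folklore] -/
theorem monoidHom_prod_eq_of_coprime {A T : Type*} [Group A] [Group T] {a t : ℕ}
    (hA : ∀ x : A, x ^ a = 1) (hT : ∀ y : T, y ^ t = 1) (hat : Nat.Coprime a t)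
    (θ : A × T →* A × T) (x : A × T) : θ x = ((θ (x.1, 1)).1, (θ (1, x.2)).2) := by
  have hone : ((1 : A), (1 : T)) = 1 := rfl
  have h2 : (θ (x.1, 1)).2 = 1 := by
    have hu1 : (θ (x.1, 1)).2 ^ a = 1 := by
      rw [← Prod.pow_snd, ← map_pow, Prod.pow_mk, hA, one_pow, hone, map_one]; rfl
    have := pow_gcd_eq_one.2 ⟨hu1, hT _⟩
    rwa [Nat.Coprime.gcd_eq_one hat, pow_one] at this
  have h1 : (θ (1, x.2)).1 = 1 := by
    have hu2 : (θ (1, x.2)).1 ^ t = 1 := by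
      rw [← Prod.pow_fst, ← map_pow, Prod.pow_mk, hT, one_pow, hone, map_one]; rfl
    have := pow_gcd_eq_one.2 ⟨hA _, hu2⟩
    rwa [Nat.Coprime.gcd_eq_one hat, pow_one] at this
  calc θ x = θ ((x.1, 1) * (1, x.2)) := by rw [Prod.mk_mul_mk, mul_one, one_mul]
    _ = θ (x.1, 1) * θ (1, x.2) := map_mul _ _ _
    _ = ((θ (x.1, 1)).1, (θ (1, x.2)).2) :=
        Prod.ext (by rw [Prod.fst_mul, h1, mul_one]) (by rw [Prod.snd_mul, h2, one_mul])

end Diagonal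

section ProdFiltered

variable {K : Type*} [Field K] {A : Type*} [Group A] [Fintype A] [DecidableEq A]
  {Λ : Type*} [Fintype Λ] {T : Type*} [Group T] [Fintype T] [DecidableEq T]

/-- **Product with the trivial grading is filtered for diagonal maps**: if `f = f₁ × f₂` and the
`A`-coordinates are filtered for `f₁` (the `β_j`-coordinate of the push-forward of `β_{j'}`
vanishes when `deg j < deg j'`), then the tensor coordinates `β_j ⊗ δ_u` of `K[A × T] = K[A] ⊗ K[T]`
with the degree of the first factor are filtered for `f`. [this work] -/
theorem prod_trivial_pushforward_filtered (B₁ : GradedCoords K A Λ) (f : A × T → A × T)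
    (f₁ : A → A) (f₂ : T → T) (hf : ∀ x, f x = (f₁ x.1, f₂ x.2)) (j' j : Λ × T)
    (h1 : B₁.deg j.1 < B₁.deg j'.1 → ∑ x', B₁.P j'.1 x' * B₁.Q (f₁ x') j.1 = 0)
    (h : (B₁.prod (GradedCoords.trivial K T)).deg j <
      (B₁.prod (GradedCoords.trivial K T)).deg j') :
    ∑ x', (B₁.prod (GradedCoords.trivial K T)).P j' x' *
      (B₁.prod (GradedCoords.trivial K T)).Q (f x') j = 0 := by
  have hP : ∀ x' : A × T, (B₁.prod (GradedCoords.trivial K T)).P j' x' =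
      B₁.P j'.1 x'.1 * (if x'.2 = j'.2 then 1 else 0) := fun _ => rfl
  have hQ : ∀ x' : A × T, (B₁.prod (GradedCoords.trivial K T)).Q x' j =
      B₁.Q x'.1 j.1 * (if j.2 = x'.2 then 1 else 0) := fun _ => rfl
  have hdeg : B₁.deg j.1 < B₁.deg j'.1 := by
    simpa only [GradedCoords.prod_deg, GradedCoords.trivial_deg, add_zero] using h
  simp_rw [hP, hQ, hf]
  rw [Fintype.sum_prod_type]
  have hinner : ∀ x₁ : A, (∑ x₂ : T, B₁.P j'.1 x₁ * (if x₂ = j'.2 then (1 : K) else 0) *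
      (B₁.Q (f₁ x₁) j.1 * (if j.2 = f₂ x₂ then 1 else 0))) =
      B₁.P j'.1 x₁ * B₁.Q (f₁ x₁) j.1 * (if j.2 = f₂ j'.2 then 1 else 0) := by
    intro x₁
    rw [Finset.sum_eq_single j'.2 (fun x₂ _ hne => by simp [hne])
      (fun h => (h (Finset.mem_univ _)).elim)]
    simp only [if_true]
    ring
  simp_rw [hinner]
  rw [← Finset.sum_mul, h1 hdeg, zero_mul]

end ProdFiltered

section Coprime

variable {K : Type*} [Field K] {p : ℕ} [Fact p.Prime] {ι : Type*} [LinearOrder ι] [Fintype ι]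
  [CharP K p] {A : Type*} [Group A] [Fintype A] [DecidableEq A] (C : PCGS p A ι)
  {T : Type*} [Group T] [Fintype T] [DecidableEq T]

/-- **Twisted matchings in `A × T`, `p ∤ |T|`**: for a `p`-central generating system of `A` whose
levels all endomorphisms respect and a finite group `T` of order prime to `p`, a twisted matching
in `A × T` with finitely many automorphism-pair twists `(φ_s, ψ_s)` and weights with non-zero
diagonal sums has at most `(#{deg < a} + #{deg < b} + #{deg ≥ a+b})·|T|` elements, the counts
referring to the monomial basis of `K[A]`. [this work] -/
theorem card_le_of_coprimeTwistedMatching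
    (hS : ∀ (φ : A →* A) (a : ι), φ (C.gen a) ∈ Subgroup.closure (C.gen '' {b | C.lvl a ≤ C.lvl b}))
    (hT : Nat.Coprime p (Fintype.card T))
    {σ : Type*} [Fintype σ] (t : σ → K) (φ ψ : σ → (A × T) ≃* (A × T)) {ι' : Type*} [Fintype ι']
    (x y z : ι' → A × T)
    (hoff : ∀ (i j l : ι') (s : σ), x i * φ s (y j) * ψ s (z l) = 1 → i = j ∧ j = l)
    (hdiag : ∀ i : ι', (∑ s, t s * (if x i * φ s (y i) * ψ s (z i) = 1 then (1 : K) else 0)) ≠ 0)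
    (a b : ℕ) :
    Fintype.card ι' ≤ (Fintype.card {e : ι → Fin p // C.deg e < a} +
      Fintype.card {e : ι → Fin p // C.deg e < b} +
      Fintype.card {e : ι → Fin p // a + b ≤ C.deg e}) * Fintype.card T := by
  classical
  have hgen : ∀ (φ : A →* A) (a : ι), MonoidAlgebra.of K A (φ (C.gen a)) - 1 ∈ C.M K (C.W a) :=
    fun φ a => pcgs_of_sub_one_mem_M_W C a (hS φ a)
  -- exponents: `x^{p^{|ι|}} = 1` on `A`, `y^{|T|} = 1` on `T`, coprime
  have hA : ∀ u : A, u ^ p ^ Fintype.card ι = 1 := fun u => by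
    have h := pow_card_eq_one (x := u)
    rwa [← Nat.card_eq_fintype_card, C.card_eq] at h
  have hTT : ∀ v : T, v ^ Fintype.card T = 1 := fun v => pow_card_eq_one
  have hcop : Nat.Coprime (p ^ Fintype.card ι) (Fintype.card T) := Nat.Coprime.pow_left _ hT
  -- any automorphism `θ` of `A × T` is diagonal with an endomorphism of `A` in the first slot,
  -- hence filtered for the product coordinates
  have hfilt : ∀ (θ : (A × T) ≃* (A × T)) (j' j : (ι → Fin p) × T),
      ((C.gradedCoords K).prod (GradedCoords.trivial K T)).deg j <
        ((C.gradedCoords K).prod (GradedCoords.trivial K T)).deg j' →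
      ∑ x', ((C.gradedCoords K).prod (GradedCoords.trivial K T)).P j' x' *
        ((C.gradedCoords K).prod (GradedCoords.trivial K T)).Q (θ x') j = 0 := by
    intro θ j' j hlt
    refine prod_trivial_pushforward_filtered (C.gradedCoords K) (fun g => θ g)
      (fun u => (θ (u, 1)).1) (fun v => (θ (1, v)).2)
      (fun g => monoidHom_prod_eq_of_coprime hA hTT hcop θ.toMonoidHom g) j' j ?_ hlt
    intro h1
    have := pcgs_pushforward_filtered_of_gen C (K := K)
      ((MonoidHom.fst A T).comp (θ.toMonoidHom.comp (MonoidHom.inl A T))) (hgen _) j'.1 j.1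
      (by simpa only [PCGS.gradedCoords_deg] using h1)
    simpa only [MonoidHom.coe_comp, Function.comp_apply, MonoidHom.coe_fst,
      MonoidHom.inl_apply, MulEquiv.toMonoidHom_eq_coe, MonoidHom.coe_coe] using this
  have h := card_le_of_twistedMatching ((C.gradedCoords K).prod (GradedCoords.trivial K T)) t
    (fun s g => φ s g) (fun s g => ψ s g) ?_ ?_ x y z hoff hdiag a b
  · have e1 : Fintype.card {i : (ι → Fin p) × T //
        ((C.gradedCoords K).prod (GradedCoords.trivial K T)).deg i < a} =
        Fintype.card {e : ι → Fin p // C.deg e < a} * Fintype.card T :=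
      GradedCoords.card_prod_trivial (C.gradedCoords K) (· < a)
    have e2 : Fintype.card {i : (ι → Fin p) × T //
        ((C.gradedCoords K).prod (GradedCoords.trivial K T)).deg i < b} =
        Fintype.card {e : ι → Fin p // C.deg e < b} * Fintype.card T :=
      GradedCoords.card_prod_trivial (C.gradedCoords K) (· < b)
    have e3 : Fintype.card {i : (ι → Fin p) × T //
        a + b ≤ ((C.gradedCoords K).prod (GradedCoords.trivial K T)).deg i} =
        Fintype.card {e : ι → Fin p // a + b ≤ C.deg e} * Fintype.card T :=
      GradedCoords.card_prod_trivial (C.gradedCoords K) (a + b ≤ ·)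
    rw [e1, e2, e3] at h
    simpa only [add_mul] using h
  · intro s j' j hlt
    exact hfilt (φ s) j' j hlt
  · intro s k k' hlt
    have h1 : ∀ g : A × T, (ψ s g⁻¹)⁻¹ = ψ s g := fun g => by rw [map_inv, inv_inv]
    simp_rw [h1]
    rw [show (∑ g, ((C.gradedCoords K).prod (GradedCoords.trivial K T)).P k (ψ s g) *
        ((C.gradedCoords K).prod (GradedCoords.trivial K T)).Q g k') =
        ∑ x', ((C.gradedCoords K).prod (GradedCoords.trivial K T)).P k x' *
          ((C.gradedCoords K).prod (GradedCoords.trivial K T)).Q ((ψ s).symm x') k' from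
      Fintype.sum_equiv (ψ s).toEquiv _ _ (fun g => by simp)]
    exact hfilt (ψ s).symm k k' hlt

end Coprime

end Summit.MatrixMultiplication.MatrixMultiplication.Theorems.TwistedSliceRank
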